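import Literature.Barriers.PneNP.TSPExtensionComplexityRothvossTransport
import Mathlib.Data.Fin.Embedding
import HarnessLib

/-!
# T-SOC (cell pnp-psdrank, rung F-N2.SOC): the face `P_PM(N) ↪ P_PM(n)` at factorization level

For `N ≤ n` with `n − N` even: the embedding `Fin N ↪ Fin n`, a fixed perfect matching `M₀` on the new vertices,
the lift `M' ↦ ι(M') ∪ M₀` of perfect matchings (`liftPM`, `liftPM_isPMOn`) and the invariance of the odd-cut slack
`|δ(ιU') ∩ lift M'| = |δ(U') ∩ M'|` (`card_cut_liftPM`, via the tree's `card_cut_image`). Shared by the closers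
`SmallBlockRothvossTarget` (b = 2) and `SmallBlockRothvossTargetB` (all fixed `b`); the same construction as the
tree's `Literature.Combinatorics.Optimization.HasBlockPsdFactorization.of_le` (p415122), kept here at the level of
the raw data so that closers need not wait for that module's olean. Source: HOME/pnp-psdrank-eng/lean/SocLift.lean
Part D (eng g3; ref g13 audit PASS).
-/

set_option linter.dupNamespace false -- `Summit.PneNP.PneNP.…`: summit = sub-problem (D-0017)

noncomputable section

open scoped Classical

namespace Summit.PneNP.PneNP.Theorems.SmallBlockRothvoss

open Finset Literature.Barriers.PneNP

section Face

variable {N n : ℕ} (hNn : N ≤ n)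

/-- The embedding `Fin N ↪ Fin n`. -/
def emb : Fin N ↪ Fin n := Fin.castLEEmb hNn

/-- The new vertices. -/
def rest : Finset (Fin n) := univ \ univ.map (emb hNn)

/-- The new vertices number `n − N`. -/
theorem card_rest : (rest hNn).card = n - N := by
  unfold rest
  rw [card_univ_sdiff, card_map, Fintype.card_fin, card_univ, Fintype.card_fin]

/-- Old and new vertices are disjoint. -/
theorem disjoint_rest : Disjoint (univ.map (emb hNn)) (rest hNn) := disjoint_sdiff

/-- Old and new vertices cover everything. -/
theorem union_rest : univ.map (emb hNn) ∪ rest hNn = univ := union_sdiff_of_subset (subset_univ _)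

/-- Lift of an edge set of `K_N`: its image together with a fixed edge set `M₀` on the new vertices. -/
def liftPM (M₀ : Finset (Sym2 (Fin n))) (M' : Finset (Sym2 (Fin N))) : Finset (Sym2 (Fin n)) :=
  M'.image (Sym2.map (emb hNn)) ∪ M₀

/-- The lift of a perfect matching is a perfect matching. -/
theorem liftPM_isPMOn {M₀ : Finset (Sym2 (Fin n))} (hM₀ : IsPMOn (rest hNn) M₀)
    {M' : Finset (Sym2 (Fin N))} (hM' : IsPMOn univ M') : IsPMOn univ (liftPM hNn M₀ M') := by
  have h1 := hM'.image (emb hNn) ((emb hNn).injective.injOn)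
  rw [← map_eq_image] at h1
  have h2 := h1.union hM₀ (disjoint_rest hNn)
  rwa [union_rest] at h2

/-- Edges on the new vertices do not cross a lifted vertex set. -/
theorem cutCount_rest {M₀ : Finset (Sym2 (Fin n))} (hM₀ : IsPMOn (rest hNn) M₀) (U' : Finset (Fin N))
    {f : Sym2 (Fin n)} (hf : f ∈ M₀) : cutCount (U'.map (emb hNn)) f ≠ 1 := by
  induction f using Sym2.ind with
  | h a b =>
    have ha : a ∈ rest hNn := hM₀.mem_of_mem hf (Sym2.mem_mk_left a b)
    have hb : b ∈ rest hNn := hM₀.mem_of_mem hf (Sym2.mem_mk_right a b)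
    have hsub : U'.map (emb hNn) ⊆ univ.map (emb hNn) := map_subset_map.2 (subset_univ U')
    have ha' : a ∉ U'.map (emb hNn) := fun h => (mem_sdiff.1 ha).2 (hsub h)
    have hb' : b ∉ U'.map (emb hNn) := fun h => (mem_sdiff.1 hb).2 (hsub h)
    rw [cutCount_mk, if_neg ha', if_neg hb']
    norm_num

/-- **The odd-cut slack is preserved by the lift**: `|δ(ιU') ∩ lift(M')| = |δ(U') ∩ M'|`. -/
theorem card_cut_liftPM {M₀ : Finset (Sym2 (Fin n))} (hM₀ : IsPMOn (rest hNn) M₀) (U' : Finset (Fin N))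
    (M' : Finset (Sym2 (Fin N))) :
    ((liftPM hNn M₀ M').filter fun f => cutCount (U'.map (emb hNn)) f = 1).card =
      (M'.filter fun f => cutCount U' f = 1).card := by
  unfold liftPM
  rw [filter_union]
  have h0 : M₀.filter (fun f => cutCount (U'.map (emb hNn)) f = 1) = ∅ :=
    filter_eq_empty_iff.2 fun f hf => cutCount_rest hNn hM₀ U' hf
  rw [h0, union_empty]
  exact card_cut_image (emb hNn) U' M'

end Face

end Summit.PneNP.PneNP.Theorems.SmallBlockRothvoss

end
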